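import Literature.NumberTheory.PAdicHodge.AinfWeierstrassEtaPeriod
import HarnessLib

/-!
# `θ` of the η-period: `θ(∫_t η) = −Σ_{i≥0} pⁱ R_p(u_{i+1})`, and transversality to `Fil¹`

Topic `Literature/NumberTheory/PAdicHodge`; sequel of `AinfWeierstrassEtaPeriod` (the Banach-free η-period
`∫_t η = η₀(T₀) − ι(corr t)`, `corr t = Σ_{i≥1} p^{i−1} R_p(Tᵢ) ∈ 𝔸_inf`, of a `[p]`-compatible sequence `t = (uᵢ)` of points
of `Ŵ(𝔪_{ℂ_F})`). The main term `η₀(T₀)` lies in `Fil¹ = ker θ_dR` (`T₀ = [t] ∈ Fil¹`, `η₀(0) = 0`), and `θ` is continuous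
and compatible with evaluation of integral power series (`θ(R_p(Tᵢ)) = R_p(θTᵢ) = R_p(uᵢ)`), so

  **`θ_dR(∫_t η) = −θ(corr t)`,  `θ(corr t) = lim_n Σ_{i<n} pⁱ R_p(u_{i+1})`  (`p`-adically in `𝒪_{ℂ_F}`),**

with the explicit error `θ(corr t) − Σ_{i≤n} pⁱ R_p(u_{i+1}) ∈ p^{n+1}𝒪_{ℂ_F}`. In particular `θ(corr t) ≡ R_p(u₁) (mod p)`,
whence the **transversality criterion**: if `R_p(u₁) ∉ p𝒪_{ℂ_F}` then `θ_dR(∫_t η) ≠ 0`, i.e. `∫_t η ∉ Fil¹ B_dR⁺`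
(`etaPeriod_not_mem_filOne`). (For a supersingular `W` over `ℤ_p` and `u₁` of exact order `p`, `v(u₁) = 1/(p²−1)` and
`R_p = c·Xᵖ + …` with `c ∈ ℤ_pˣ` up to terms in `pℤ⟦X⟧ + X^{p+1}ℤ⟦X⟧`, so `v(R_p(u₁)) = p/(p²−1) < 1`: Colmez 1992 §2;
this numerical input is NOT proved here — the criterion isolates it as the single hypothesis `h₁`.)

* §1 `mulDefectC W u = R_p(u) ∈ 𝒪_{ℂ_F}`, `θ(R_p(Tᵢ)) = R_p(uᵢ)`, `θ(Sₙ) = Σ_{i<n} pⁱR_p(u_{i+1})` (`theta_etaCorrPartial`);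
* §2 `θ(corr t) − Σ_{i≤n} pⁱR_p(u_{i+1}) ∈ (p)^{n+1}` (`theta_etaCorr_sub_mem`), the limit (`tendsto_thetaCorrPartial`),
  `θ(corr t) ≡ R_p(u₁) (mod p)`;
* §3 `θ_dR(η₀(T₀)) = 0`, **`θ_dR(∫_t η) = −θ(corr t)`** (`thetaBdR_etaPeriod`), **`R_p(u₁) ∉ (p) ⇒ θ_dR(∫_t η) ≠ 0` and
  `∫_t η ∉ Fil¹`** (`thetaBdR_etaPeriod_ne_zero`, `etaPeriod_not_mem_filOne`).

BSD context: crux K★ `stmt-BirchSwinnertonDyer-22226`, hDR sector (iii) road (A): `∫_t ω ∈ Fil¹` and `∫_t η ∉ Fil¹` make the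
two period maps `T_pŴ → B_dR⁺` independent, the dimension count behind "`V_pŴ` is de Rham". BSD is not proved by any of this.

## References
* P. Colmez, *Périodes p-adiques des variétés abéliennes*, Math. Ann. 292 (1992), §2. [Colmez1992PeriodesAbeliennes]
* J.-M. Fontaine, *Le corps des périodes p-adiques*, Astérisque 223 (1994), Exp. II §1.2, §1.5. [FontaineAsterisque223III]
* N. M. Katz, *Crystalline cohomology, Dieudonné modules, and Jacobi sums* (1981), §5.1. [Katz1981CrystallineDieudonne]
-/

noncomputable section

open Ideal Filter Topology Field WittVector MvPowerSeries

namespace Literature.NumberTheory.PAdicHodge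

open Literature.NumberTheory.GaloisRepresentations
open Literature.NumberTheory.GaloisRepresentations.IsNonarchimedeanLocalField
open Literature.NumberTheory.GaloisRepresentations.LubinTate

namespace AinfTop

variable {F : Type} [Field F] [ValuativeRel F] [TopologicalSpace F] [IsNonarchimedeanLocalField F] [CharZero F]
  {p : ℕ} [Fact p.Prime] [Fact (¬ IsUnit (p : integerC F))]
  [IsAdicComplete (Ideal.span {(p : integerC F)}) (integerC F)]
  {hθ : Function.Surjective (fontaineTheta (integerC F) p)}
  (W : WeierstrassCurve ℤ)

/-! ## §1 `θ` of the approximants -/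

omit [CharZero F] [Fact p.Prime] [Fact (¬ IsUnit (p : integerC F))] [IsAdicComplete (Ideal.span {(p : integerC F)}) (integerC F)] in
/-- **`R_p(u) ∈ 𝒪_{ℂ_F}`** for a point `u ∈ Ŵ(𝔪_{ℂ_F})`: the integral multiplication defect `R_p ∈ ℤ⟦X⟧` evaluated `p`-adically.
[cite: Colmez1992PeriodesAbeliennes, §2] -/
def mulDefectC (W : WeierstrassCurve ℤ) (p : ℕ) (u : (maxNilIdealC F).toIdeal) : CBall F :=
  (evalPt₁ (maxNilIdealC F) (mulDefectInt W p) (constantCoeff_mulDefectInt W p) u : CBall F)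

omit [CharZero F] in
/-- `θ` is compatible with the `ℤ`-algebra structures. [folklore] -/
private theorem aux_theta_algebraMap_int (a : ℤ) : theta F p (algebraMap ℤ (AinfTop F p) a) = algebraMap ℤ (CBall F) a := by
  rw [algebraMap_int_eq, algebraMap_int_eq, eq_intCast, eq_intCast, map_intCast]

/-- **`θ(R_p(Tᵢ)) = R_p(uᵢ)`** (`θ` commutes with evaluation of the integral series `R_p`, and `θ(Tᵢ) = uᵢ`).
[cite: FontaineAsterisque223III, Exp. II §1.2.2] -/
theorem theta_mulDefectAt {t : ℕ → (maxNilIdealC F).toIdeal} (htp : ∀ n, mulPC F p W (t (n + 1)) = t n) (i : ℕ) :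
    theta F p (mulDefectAt W hθ t htp i) = mulDefectC W p (t i) := by
  rw [mulDefectAt, mulDefectC]
  exact theta_evalPt aux_theta_algebraMap_int _ (constantCoeff_mulDefectInt W p)
    (fun _ : Unit => torsionLiftShiftPt W hθ t htp i) (fun _ : Unit => t i) fun _ => theta_torsionLiftShift W htp i

omit [CharZero F] [Fact p.Prime] [Fact (¬ IsUnit (p : integerC F))] [IsAdicComplete (Ideal.span {(p : integerC F)}) (integerC F)] in
/-- The `p`-adic partial sums `Σ_{i<n} pⁱ R_p(u_{i+1}) ∈ 𝒪_{ℂ_F}`. [cite: Colmez1992PeriodesAbeliennes, §2] -/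
def thetaCorrPartial (W : WeierstrassCurve ℤ) (p : ℕ) (t : ℕ → (maxNilIdealC F).toIdeal) (n : ℕ) : CBall F :=
  ∑ i ∈ Finset.range n, (p : CBall F) ^ i * mulDefectC W p (t (i + 1))

/-- **`θ(Sₙ) = Σ_{i<n} pⁱ R_p(u_{i+1})`.** [cite: Colmez1992PeriodesAbeliennes, §2] -/
theorem theta_etaCorrPartial {t : ℕ → (maxNilIdealC F).toIdeal} (htp : ∀ n, mulPC F p W (t (n + 1)) = t n) (n : ℕ) :
    theta F p (etaCorrPartial W hθ t htp n) = thetaCorrPartial W p t n := by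
  rw [etaCorrPartial, thetaCorrPartial, map_sum]
  refine Finset.sum_congr rfl fun i _ => ?_
  rw [map_mul, map_pow, map_natCast, theta_mulDefectAt W (hθ := hθ) htp]

/-! ## §2 `θ(corr t)` as a `p`-adic limit -/

/-- **`θ(corr t) − Σ_{i≤n} pⁱ R_p(u_{i+1}) ∈ p^{n+1}𝒪_{ℂ_F}`** (`corr t − S_{n+1} ∈ (p, ξ)^{n+1}` and `θ(p, ξ) = (p)`).
[cite: Colmez1992PeriodesAbeliennes, §2] -/
theorem theta_etaCorr_sub_mem {t : ℕ → (maxNilIdealC F).toIdeal} (htp : ∀ n, mulPC F p W (t (n + 1)) = t n) (n : ℕ) :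
    theta F p (etaCorr W hθ t htp) - thetaCorrPartial W p t (n + 1) ∈ Ideal.span {(p : CBall F)} ^ (n + 1) := by
  rw [← theta_etaCorrPartial W (hθ := hθ) htp (n + 1), ← map_sub]
  exact theta_mem_span_pow_of_mem_pow (etaCorr_sub_partial_mem W htp n)

/-- **`θ(corr t) = lim_n Σ_{i<n} pⁱ R_p(u_{i+1})`** (`p`-adically in `𝒪_{ℂ_F}`; continuity of `θ`).
[cite: Colmez1992PeriodesAbeliennes, §2] -/
theorem tendsto_thetaCorrPartial {t : ℕ → (maxNilIdealC F).toIdeal} (htp : ∀ n, mulPC F p W (t (n + 1)) = t n) :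
    Tendsto (fun n => thetaCorrPartial W p t (n + 1)) atTop (𝓝 (theta F p (etaCorr W hθ t htp))) := by
  have h := ((continuous_theta (F := F) (p := p)).tendsto _).comp (tendsto_etaCorrPartial W (hθ := hθ) htp)
  exact h.congr fun n => theta_etaCorrPartial W htp (n + 1)

/-- **`θ(corr t) ≡ R_p(u₁) (mod p)`.** [cite: Colmez1992PeriodesAbeliennes, §2] -/
theorem theta_etaCorr_sub_mulDefectC_mem {t : ℕ → (maxNilIdealC F).toIdeal} (htp : ∀ n, mulPC F p W (t (n + 1)) = t n) :
    theta F p (etaCorr W hθ t htp) - mulDefectC W p (t 1) ∈ Ideal.span {(p : CBall F)} := by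
  have h := theta_etaCorr_sub_mem W (hθ := hθ) htp 0
  rwa [zero_add, pow_one, thetaCorrPartial, Finset.sum_range_one, pow_zero, one_mul, zero_add] at h

/-! ## §3 `θ_dR` of the η-period and transversality to `Fil¹` -/

/-- `θ_dR(η₀(T₀)) = 0`: the main term lies in `Fil¹ = (ξ_dR) = ker θ_dR`. [cite: FontaineAsterisque223III, Exp. II §1.5.2] -/
theorem thetaBdR_etaPeriodMain {t : ℕ → (maxNilIdealC F).toIdeal} (ht0 : (t 0 : CBall F) = 0)
    (htp : ∀ n, mulPC F p W (t (n + 1)) = t n) :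
    thetaBdR ((BdRPlusTop.of F p).symm (etaPeriodMain W hθ t ht0 htp)) = 0 :=
  thetaBdR_eq_zero_of_mem_span (BdRPlusTop.mem_filOne_iff.1
    (evalPt₁ (BdRPlusTop.filOne F p) (etaSeries W) (constantCoeff_etaSeries W) (torsionLiftFil W hθ t ht0 htp)).2)

/-- `θ_dR ∘ ι = θ` on `𝔸_inf`. [cite: FontaineAsterisque223III, Exp. II §1.5.2] -/
theorem thetaBdR_ofAinf (a : AinfTop F p) :
    thetaBdR ((BdRPlusTop.of F p).symm (BdRPlusTop.ofAinf F p ((of F p).symm a))) =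
      ((theta F p a : CBall F) : CompletedAlgClosure F) := by
  have h := coe_theta (F := F) (p := p) ((of F p).symm a)
  rw [RingEquiv.apply_symm_apply] at h
  rw [h]
  exact thetaBdR_ainfToBdR ((of F p).symm a)

/-- **`θ_dR(∫_t η) = −θ(corr t)`** (`= −Σ_{i≥0} pⁱ R_p(u_{i+1})` by `tendsto_thetaCorrPartial`). [cite: Colmez1992PeriodesAbeliennes, §2] -/
theorem thetaBdR_etaPeriod {t : ℕ → (maxNilIdealC F).toIdeal} (ht0 : (t 0 : CBall F) = 0)
    (htp : ∀ n, mulPC F p W (t (n + 1)) = t n) :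
    thetaBdR ((BdRPlusTop.of F p).symm (etaPeriod W hθ t ht0 htp)) =
      -((theta F p (etaCorr W hθ t htp) : CBall F) : CompletedAlgClosure F) := by
  rw [etaPeriod, map_sub, map_sub, thetaBdR_etaPeriodMain, thetaBdR_ofAinf, zero_sub]

/-- **Transversality criterion: `R_p(u₁) ∉ p𝒪_{ℂ_F} ⇒ θ_dR(∫_t η) ≠ 0`.** [cite: Colmez1992PeriodesAbeliennes, §2] -/
theorem thetaBdR_etaPeriod_ne_zero {t : ℕ → (maxNilIdealC F).toIdeal} (ht0 : (t 0 : CBall F) = 0)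
    (htp : ∀ n, mulPC F p W (t (n + 1)) = t n) (h₁ : mulDefectC W p (t 1) ∉ Ideal.span {(p : CBall F)}) :
    thetaBdR ((BdRPlusTop.of F p).symm (etaPeriod W hθ t ht0 htp)) ≠ 0 := by
  rw [thetaBdR_etaPeriod, neg_ne_zero]
  intro h0
  apply h₁
  have hθ0 : theta F p (etaCorr W hθ t htp) = 0 := Subtype.ext (by rw [h0, ZeroMemClass.coe_zero])
  have h := theta_etaCorr_sub_mulDefectC_mem W (hθ := hθ) htp
  rwa [hθ0, zero_sub, Ideal.neg_mem_iff] at h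

/-- **`R_p(u₁) ∉ p𝒪_{ℂ_F} ⇒ ∫_t η ∉ Fil¹ B_dR⁺`**: the η-period is transverse to the Hodge filtration step containing
`∫_t ω`. [cite: Colmez1992PeriodesAbeliennes, §2] -/
theorem etaPeriod_not_mem_filOne {t : ℕ → (maxNilIdealC F).toIdeal} (ht0 : (t 0 : CBall F) = 0)
    (htp : ∀ n, mulPC F p W (t (n + 1)) = t n) (h₁ : mulDefectC W p (t 1) ∉ Ideal.span {(p : CBall F)}) :
    etaPeriod W hθ t ht0 htp ∉ (BdRPlusTop.filOne F p).toIdeal := fun h =>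
  thetaBdR_etaPeriod_ne_zero W ht0 htp h₁ (thetaBdR_eq_zero_of_mem_span (BdRPlusTop.mem_filOne_iff.1 h))

end AinfTop

end Literature.NumberTheory.PAdicHodge

end
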